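import Summits.ABC.IUTFork.Cor312LinScaledModel
import HarnessLib

/-!
# [IUTchIII] Cor. 3.12 — the LIN-SCALED bed P♮ˡ, III: Step (x), the typed Theorem 3.11, pilots/regions, the (Ind1)-orbit and the hull, the volumes

Proof-only file (D-0012; no definition, no `Prop` fact) of the abc-iut cell (IUT REPAIR branch B, seat abc-iut-rp-x3 gen 4; rung LADDER-ABC:A2.RP;
abc-iut-rp-plan ruling (R30) 2026-08-26T12:39:05Z), sequel of `Cor312DeepGradedBoxes` (cap-parametric frame/volume/region operator) and
`Cor312LinScaledModel` (the bed P♮ˡ: asymmetric honest Θ-profile `thetaDepth`, natural q-profile `qDepth`, profile points, data, setting).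
TAKES NO SIDE on [IUTchIII] Cor. 3.12 and no side between Mochizuki, Scholze–Stix, Joshi or Dupuy–Hilado; typed ≠ proved; model data ≠ intended
objects. Every proof is the P♮ₑ proof of abc-iut-rp-h3 (`Cor312OrbitExcursionThm311`) re-run on the deep frame; P♮ₑ's lemmas are used BY NAME.

§7 Step (x): `deepVol capL` is invariant under ⟨(Ind1)∪(Ind2)⟩ (`linData_logvolInvariant`, non-trivially: graded boxes move). §8 the profile
points: coordinates, membership in the sub-packet `𝓘^ℚ(^{S^±_{j+1},j};−)_v` of the bad valuation (typed Thm. 3.11 (i)(a) HONESTLY), depth profile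
(`pointDepthD_profilePt`), the deep regions of the two data (`deepRegion_theta`/`deepRegion_q`). §9 **the typed Theorem 3.11 (i) ∧ (ii) ∧ (iii)
HOLDS for `linFull`** (`linFull_statement`). §10 pilots of exponent `1`; Θ-region `gbox (thetaDepth j)`, q-region `gbox (qDepth j)`; every
possible image is a PERMUTED Θ-box and the boxes moved by `moveLast i` are possible images; the union is bounded; **the hull is
`gbox (topDepth j j³)`** (`linSetting_thetaHull`: only the coordinate `c ≡ true` survives the class-wise minimum — depth `j³ = 1, 8`). §11 the
volumes: `qLocal = −3/4` at BOTH labels (natural), `logvol(Θ-region) = j²·qLocal` at every `m` and for the (Ind3)-union (HONEST), `thetaLocal =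
−j³/2^{j+1}` (`−1/4`, `−1`: ONE THIRD of the Θ-volumes `−3/4`, `−3`), `ThetaFinite`. Interface-level toy (`l⋇ = 2`, one place).
[claim: Mochizuki2012, status: disputed] for every IUT noun. [cite: ScholzeStix2018, §2.2 pp. 9–10] [cite: DupuyHilado2020, §4.7, §6.2]
-/

noncomputable section

open Set

namespace Summit.ABC.IUTFork.Cor312Vol

namespace LinScaledWitness

open Thm311 Cor312 Cor312.IdentifiedNonVacuity NaiveWitness PinnedWitness SplitWitness ExcursionWitness DeepBoxes
  Literature.IUT.LogThetaLattice

/-! ## 7. Step (x): the volume of P♮ˡ is invariant under ⟨(Ind1)∪(Ind2)⟩ -/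

/-- `LogvolInvariant` of the data of P♮ˡ (abc-iut-c312-1's Step (x) side condition), PROVED — non-trivially: capsule permutations move graded
boxes, the average depth is unchanged. [folklore] -/
theorem linData_logvolInvariant : linData.LogvolInvariant := fun Φ hΦ j vQ A _ => by
  have hp : ActsByPerm Φ := by
    rcases hΦ with h1 | h2
    · exact actsByPerm_of_mem_Ind1Family h1
    · exact actsByPerm_of_mem_Ind2Family h2
  obtain ⟨σ, hσ⟩ := hp j vQ
  exact deepVol_image_of_perm capL hσ A

/-! ## 8. The profile points: sub-packet, boundedness, depth profile; the deep regions of the two data -/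

/-- **A profile point lies in the SUB-PACKET `𝓘^ℚ(^{S^±_{j+1},j};−)_v` of the bad valuation**: every elementary tensor `e_c` with `c(j) = true`
has its last factor supported on the summand `v = true`, and the other coefficients vanish ([IUTchIII] Prop. 3.4 (ii): the splitting monoid
«as a subset of ∏_j 𝓘^ℚ(^{S^±_{j+1},j};𝒟^⊢_v)»). [folklore] -/
theorem profilePt_mem_subPacket (d : ∀ j : splitIndex.Label, (splitIndex.Caps j → Bool) → ℕ) (j : splitIndex.Label) :
    profilePt d j () ∈ splitShells.SubPacket j true := by
  unfold profilePt
  refine Submodule.sum_mem _ fun c _ => ?_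
  by_cases hc : c (Fin.last _) = true
  · refine Submodule.smul_mem _ _ (Submodule.subset_span ⟨eFn j () c, fun w hw => ?_, rfl⟩)
    show (if w.1 = c (Fin.last _) then (1 : ℚ) else 0) = 0
    rw [hc, if_neg hw]
  · rw [if_neg hc, zero_smul]; exact Submodule.zero_mem _

/-- A profile point is bounded: it lies in the unit box. [folklore] -/
theorem profilePt_mem_gbox_zero (d : ∀ j : splitIndex.Label, (splitIndex.Caps j → Bool) → ℕ) (j : splitIndex.Label) (vQ : splitIndex.VQ) :
    profilePt d j vQ ∈ (gbox 0 : Set (splitShells.Packet j vQ)) := fun c => by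
  show |coord j vQ c (profilePt d j vQ)| * (2 : ℚ) ^ (0 : ℕ) ≤ 1
  rw [coord_profilePt, pow_zero, mul_one]
  split_ifs
  · rw [abs_of_nonneg (by positivity), inv_pow]
    exact inv_le_one_of_one_le₀ (one_le_pow₀ (by norm_num))
  · rw [abs_zero]; exact zero_le_one

/-- The singleton of a profile point lies in the slab of depth `e` on a usable coordinate `c` (`c(j) = true`) iff `e ≤ d j c`. [folklore] -/
theorem singleton_profilePt_subset_slab_iff (d : ∀ j : splitIndex.Label, (splitIndex.Caps j → Bool) → ℕ) {j : splitIndex.Label}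
    (vQ : splitIndex.VQ) (e : ℕ) {c : splitIndex.Caps j → Bool} (hc : c (Fin.last _) = true) :
    ({profilePt d j vQ} : Set (splitShells.Packet j vQ)) ⊆ slab c e ↔ e ≤ d j c := by
  rw [Set.singleton_subset_iff]
  show |coord j vQ c _| * (2 : ℚ) ^ e ≤ 1 ↔ _
  rw [coord_profilePt, if_pos hc, abs_of_nonneg (by positivity), inv_pow, inv_mul_le_iff₀ (by positivity), mul_one]
  exact pow_le_pow_iff_right₀ (by norm_num : (1 : ℚ) < 2)

/-- **The capped depth profile of a profile point IS its profile** (for a profile capped by `capL` and vanishing off the usable coordinates).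
[folklore] -/
theorem pointDepthD_profilePt {d : ∀ j : splitIndex.Label, (splitIndex.Caps j → Bool) → ℕ} (hd : ∀ j c, d j c ≤ capL)
    (hd0 : ∀ j (c : splitIndex.Caps j → Bool), c (Fin.last _) = false → d j c = 0) {j : splitIndex.Label} (vQ : splitIndex.VQ)
    (c : splitIndex.Caps j → Bool) : pointDepthD capL (profilePt d j vQ) c = d j c := by
  unfold pointDepthD
  rw [coord_profilePt]
  by_cases hc : c (Fin.last _) = true
  · rw [if_pos hc, if_neg (by positivity : (0 : ℚ) < (2 : ℚ)⁻¹ ^ d j c).ne']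
    exact depthAtD_eq capL ((singleton_profilePt_subset_slab_iff d vQ _ hc).2 le_rfl) (hd j c) fun h =>
      absurd ((singleton_profilePt_subset_slab_iff d vQ _ hc).1 h) (by omega)
  · rw [if_neg hc, if_pos rfl, hd0 j c (Bool.eq_false_iff.2 hc)]

/-- **The deep region of the Θ-datum at a label of `𝔽_l^⋇` is `gbox (thetaDepth j)`.** [folklore] -/
theorem deepRegion_theta {j : splitIndex.Label} (hj : j ≠ 0) (vQ : splitIndex.VQ) :
    deepRegion capL (fun v _ => {thetaStarL v}) j vQ = gbox (thetaDepth j) := by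
  rw [deepRegion_singleton capL hj]
  exact congrArg gbox (funext fun c => pointDepthD_profilePt thetaDepth_le (fun _ _ hc => thetaDepth_of_last_false hc) vQ c)

/-- **The deep region of the q-datum at a label of `𝔽_l^⋇` is `gbox (qDepth j)`.** [folklore] -/
theorem deepRegion_q {j : splitIndex.Label} (hj : j ≠ 0) (vQ : splitIndex.VQ) : deepRegion capL qDatumL j vQ = gbox (qDepth j) := by
  unfold qDatumL
  rw [deepRegion_singleton capL hj]
  exact congrArg gbox (funext fun c => pointDepthD_profilePt qDepth_le (fun _ _ hc => qDepth_of_last_false hc) vQ c)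

/-! ## 9. The typed Theorem 3.11 (i) ∧ (ii) ∧ (iii) HOLDS for P♮ˡ -/

/-- (i): the splitting monoid sits in the sub-packets (HONESTLY: profile points on the bad summand of the last factor); the degree clause; the
classes `^{n,∘}𝔯^{LGP}` coincide. [folklore] -/
theorem lin_partI : linFull.PartI := by
  refine ⟨fun n v hv x hx j => ?_, fun n j k => ⟨fun vQ => trivial, Set.toFinite _, ?_⟩, fun _ _ => rfl⟩
  · have hv' : v = true := hv
    subst hv'
    rw [show x = thetaStarL true from hx]
    exact profilePt_mem_subPacket _ j.1
  · show deepVol capL j.1 () (gbox 0) = ∑ᶠ vQ : splitIndex.VQ, deepVol capL j.1 vQ (gbox 0)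
    rw [finsum_unique]

/-- (ii), column by column: identity Kummer transport, (Ind3) = `gbox 0 ⊆ gbox 0`, no archimedean place. [folklore] -/
theorem lin_partII : linFull.toLatticeSituation.PartII := fun _ =>
  (Column.partII_iff _ _).2
    ⟨fun _ _ _ _ _ => ⟨trivial, rfl⟩, fun _ _ _ => rfl, fun _ _ => rfl, fun _ _ _ _ _ => subset_rfl, fun _ _ _ h => absurd trivial h⟩

/-- (iii): the link data are abc-iut-w5-d247's `naiveLink`. [folklore] -/
theorem lin_partIII : linFull.PartIII := by
  refine ⟨naiveLink.partIIIa_holds, naiveLink.partIIIb_holds, ?_, fun n m => Thm311.PolyIsoCalc.stabilized_full _ _,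
    linFull.evalCompatUpToInd_of_multiradialCompat lin_partI.2.2⟩
  refine naiveLink.partIIIc_of_full (fun _ => rfl) fun n m => ?_
  rintro _ ⟨a, rfl⟩
  show unitIso a ≪≫ unitIso ((-1) ^ m.natAbs) = unitIso ((-1) ^ m.natAbs) ≪≫ unitIso a
  rw [unitIso_trans, unitIso_trans, mul_comm]

/-- **The typed Theorem 3.11 (i) ∧ (ii) ∧ (iii) HOLDS in P♮ˡ.** [folklore] -/
theorem linFull_statement : linFull.Statement := ⟨lin_partI, lin_partII, lin_partIII⟩

/-! ## 10. Pilots, regions, the (Ind1)-orbit, the hull -/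

/-- The pilots are the objects of exponent `1`. [folklore] -/
theorem linSetting_pilots : linSetting.thetaPilot = (1 : ℤ) ∧ linSetting.qPilot = (1 : ℤ) :=
  ⟨congrArg (Nat.cast : ℕ → ℤ) (expOf_eq_one_of_isGenerator_top (Classical.choose_spec (linSetting.split.exists_gen true rfl))), rfl⟩

/-- The Kummer image of the Θ-pilot at every `(m, j, v_ℚ)` is `thetaGlueL 1`. [folklore] -/
theorem linSetting_thetaRegion (m : ℤ) (j : splitIndex.Label) (vQ : splitIndex.VQ) : linSetting.thetaRegion m j vQ = thetaGlueL 1 j vQ := by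
  unfold Setting.thetaRegion; rw [linSetting_pilots.1]; rfl

/-- The (Ind3)-enlarged region is the same (no `m`-drift). [folklore] -/
theorem linSetting_thetaRegion3 (j : splitIndex.Label) (vQ : splitIndex.VQ) : linSetting.thetaRegion3 j vQ = thetaGlueL 1 j vQ := by
  show (⋃ m : ℤ, linSetting.thetaRegion m j vQ) = _
  simp_rw [linSetting_thetaRegion]; exact Set.iUnion_const _

/-- On `𝔽_l^⋇`: Θ-region `gbox (thetaDepth j)`, q-region `gbox (qDepth j)`. [folklore] -/
theorem linSetting_regions_of_ne_zero {j : splitIndex.Label} (hj : j ≠ 0) (vQ : splitIndex.VQ) :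
    linSetting.thetaRegion3 j vQ = gbox (thetaDepth j) ∧ linSetting.qRegion j vQ = gbox (qDepth j) := by
  rw [linSetting_thetaRegion3, thetaGlueL_one_of_ne_zero hj]
  exact ⟨rfl, qGlueL_one_of_ne_zero hj vQ⟩

/-- At the zero label both regions are the unit box. [folklore] -/
theorem linSetting_regions_zero (vQ : splitIndex.VQ) : linSetting.thetaRegion3 0 vQ = gbox 0 ∧ linSetting.qRegion 0 vQ = gbox 0 := by
  rw [linSetting_thetaRegion3]; exact ⟨(glueL_zero 1 vQ).1, (glueL_zero 1 vQ).2⟩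

/-- The (Ind1)-family `permFamily (moveLast i)` (abc-iut-rp-h3) lies in ⟨(Ind1)∪(Ind2)⟩ of the situation of P♮ˡ and acts by `moveLast i j`.
[folklore] -/
theorem moveFamily_mem_lin (i : ℕ) : permFamily (moveLast i) ∈ Setting.indGroup linSituation ∧
    ∀ (j : splitIndex.Label) (vQ : splitIndex.VQ) x, permFamily (moveLast i) j vQ x = splitShells.permute j vQ (moveLast i j) x :=
  ⟨Subgroup.subset_closure (Or.inl (permFamily_mem_Ind1Family _)), fun _ _ _ => rfl⟩

/-- **Every possible image of the Θ-pilot at a label of `𝔽_l^⋇` is a PERMUTED Θ-box** `gbox (c ↦ thetaDepth j (c ∘ σ))`, and for every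
capsule index `i` the box permuted by `moveLast i` IS a possible image. [folklore] -/
theorem linSetting_possibleImages {j : splitIndex.Label} (hj : j ≠ 0) (vQ : splitIndex.VQ) :
    (∀ U ∈ linSetting.possibleImages j vQ, ∃ σ : Equiv.Perm (splitIndex.Caps j), U = gbox fun c => thetaDepth j (c ∘ ⇑σ)) ∧
      ∀ i : splitIndex.Caps j, gbox (fun c => thetaDepth j (c ∘ ⇑(moveLast i.1 j))) ∈ linSetting.possibleImages j vQ := by
  refine ⟨?_, fun i => ?_⟩
  · rintro U ⟨Φ, hΦ, rfl⟩
    obtain ⟨σ, hσ⟩ := actsByPerm_of_mem_closure hΦ j vQ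
    exact ⟨σ, by rw [(linSetting_regions_of_ne_zero hj vQ).1]; exact image_gbox_of_perm hσ _⟩
  · refine ⟨permFamily (moveLast i.1), (moveFamily_mem_lin i.1).1, ?_⟩
    rw [(linSetting_regions_of_ne_zero hj vQ).1, image_gbox_of_perm ((moveFamily_mem_lin i.1).2 j vQ)]

/-- The union of the possible images is bounded (inside the unit box) at every label. [folklore] -/
theorem linSetting_sUnion_subset (j : splitIndex.Label) (vQ : splitIndex.VQ) : ⋃₀ linSetting.possibleImages j vQ ⊆ gbox 0 := by
  intro x hx
  obtain ⟨U, ⟨Φ, hΦ, rfl⟩, hxU⟩ := hx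
  obtain ⟨σ, hσ⟩ := actsByPerm_of_mem_closure hΦ j vQ
  rw [linSetting_thetaRegion3] at hxU
  by_cases hj : j = 0
  · subst hj
    rw [(glueL_zero 1 vQ).1, image_gbox_of_perm hσ] at hxU
    exact hxU
  · rw [thetaGlueL_one_of_ne_zero hj, image_gbox_of_perm hσ] at hxU
    exact gbox_antitone (fun c => Nat.zero_le _) hxU

/-- Every union of possible images admits its hull. [folklore] -/
theorem linSetting_hullDefined (j : splitIndex.Label) (vQ : splitIndex.VQ) : linSetting.HullDefined j vQ :=
  ⟨linSetting_sUnion_subset j vQ, trivial⟩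

/-- `j³ ≤ capL` for the labels of the bed (`l⋇ = 2`). [folklore] -/
theorem cube_le_capL (j : splitIndex.Label) : (j : ℕ) ^ 3 ≤ capL := by
  have hj : (j : ℕ) ≤ 2 := Nat.lt_succ_iff.1 j.2
  calc (j : ℕ) ^ 3 ≤ 2 ^ 3 := Nat.pow_le_pow_left hj 3
    _ = capL := rfl

/-- `topDepth j j³ ≤ capL`. [folklore] -/
theorem topDepth_cube_le (j : splitIndex.Label) (c : splitIndex.Caps j → Bool) : topDepth j ((j : ℕ) ^ 3) c ≤ capL := by
  unfold topDepth; split_ifs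
  · exact cube_le_capL j
  · exact Nat.zero_le _

/-- **The capped depth vector of the union of the possible images is `topDepth j j³`**: depth `j³` on `c ≡ true` (every permuted Θ-box is
exactly that deep there, the precomposition of a constant being constant; the Θ-box's witness `2^{−j³}·e_{c≡true}` is no deeper), depth `0`
on every other coordinate `c` (if `c(i) = false`, the possible image moved by `moveLast i` has depth `thetaDepth j (c ∘ moveLast i) = 0`
there — the profile vanishes off the last factor — and contains the unit witness `e_c`). [folklore] -/
theorem depthAtD_sUnion_possibleImages {j : splitIndex.Label} (hj : j ≠ 0) (vQ : splitIndex.VQ) (c : splitIndex.Caps j → Bool) :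
    depthAtD capL (⋃₀ linSetting.possibleImages j vQ) c = topDepth j ((j : ℕ) ^ 3) c := by
  unfold topDepth
  by_cases hc : c = fun _ => true
  · rw [if_pos hc]
    have hall : ∀ σ : Equiv.Perm (splitIndex.Caps j), thetaDepth j (c ∘ ⇑σ) = (j : ℕ) ^ 3 := fun σ => by
      subst hc; exact thetaDepth_top j
    have hc1 : thetaDepth j c = (j : ℕ) ^ 3 := by subst hc; exact thetaDepth_top j
    refine depthAtD_eq capL (Set.sUnion_subset fun U hU => ?_) (cube_le_capL j) fun h => ?_
    · obtain ⟨σ, rfl⟩ := (linSetting_possibleImages hj vQ).1 U hU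
      intro x hx
      have h1 : |coord j vQ c x| * (2 : ℚ) ^ thetaDepth j (c ∘ ⇑σ) ≤ 1 := hx c
      rw [hall σ] at h1
      exact h1
    · have hw : ((2 : ℚ)⁻¹ ^ ((j : ℕ) ^ 3)) • ePt j vQ c ∈ ⋃₀ linSetting.possibleImages j vQ := by
        refine Set.subset_sUnion_of_mem (linSetting.thetaRegion3_mem_possibleImages j vQ) ?_
        rw [(linSetting_regions_of_ne_zero hj vQ).1, smul_ePt_mem_gbox_iff, hc1]
        exact (smul_ePt_mem_slab_iff vQ _ c c _).1 ((pow_smul_ePt_mem_slab_iff vQ c _ _).2 le_rfl) rfl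
      have := (pow_smul_ePt_mem_slab_iff vQ c _ _).1 (h hw)
      omega
  · rw [if_neg hc]
    obtain ⟨i, hi⟩ := exists_eq_false_of_ne hc
    refine Nat.le_zero.1 (depthAtD_le_of_not_subset capL fun h => ?_)
    have h0 : thetaDepth j (c ∘ ⇑(moveLast i.1 j)) = 0 :=
      thetaDepth_of_last_false (by show c (moveLast i.1 j (Fin.last _)) = false; rw [moveLast_apply_last]; exact hi)
    have hw : (1 : ℚ) • ePt j vQ c ∈ ⋃₀ linSetting.possibleImages j vQ := by
      refine Set.subset_sUnion_of_mem ((linSetting_possibleImages hj vQ).2 i) ?_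
      rw [smul_ePt_mem_gbox_iff]
      show |(1 : ℚ)| * 2 ^ thetaDepth j (c ∘ ⇑(moveLast i.1 j)) ≤ 1
      rw [h0]; norm_num
    have h1 := (smul_ePt_mem_slab_iff vQ (1 : ℚ) c c (0 + 1)).1 (h hw) rfl
    norm_num at h1

/-- **The hull `ⁿ˒°𝒰_{j,v_ℚ}` of P♮ˡ is the graded box `gbox (topDepth j j³)`** — deep (`j³ = 1, 8`) on the single coordinate `c ≡ true`.
[folklore] -/
theorem linSetting_thetaHull {j : splitIndex.Label} (hj : j ≠ 0) (vQ : splitIndex.VQ) :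
    linSetting.thetaHull j vQ = gbox (topDepth j ((j : ℕ) ^ 3)) := by
  show (deepFrame capL j vQ).hull _ = _
  rw [deepFrame_hull capL (linSetting_sUnion_subset j vQ)]
  exact congrArg gbox (funext fun c => depthAtD_sUnion_possibleImages hj vQ c)

/-! ## 11. The volumes: natural q-side `−3/4`, honest Θ-side `j²·(−3/4)`, hull `−j³/2^{j+1}` -/

/-- The total Θ-depth at the label `i + 1` is `3·8^i` (`3` at label `1`, `24` at label `2`). [folklore] -/
theorem sum_thetaDepth (i : Fin splitIndex.lstar) : ∑ c, (thetaDepth (Setting.labelSucc i) c : ℝ) = 3 * 8 ^ (i : ℕ) := by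
  have h : (∑ c, thetaDepth (Setting.labelSucc i) c) = 3 * 8 ^ (i : ℕ) := by fin_cases i <;> decide
  have h' := congrArg (Nat.cast : ℕ → ℝ) h
  push_cast at h'
  exact h'

/-- The total q-depth at the label `i + 1` is `3·2^i` (`3` at label `1`, `6` at label `2`). [folklore] -/
theorem sum_qDepth (i : Fin splitIndex.lstar) : ∑ c, (qDepth (Setting.labelSucc i) c : ℝ) = 3 * 2 ^ (i : ℕ) := by
  have h : (∑ c, qDepth (Setting.labelSucc i) c) = 3 * 2 ^ (i : ℕ) := by fin_cases i <;> decide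
  have h' := congrArg (Nat.cast : ℕ → ℝ) h
  push_cast at h'
  exact h'

/-- The label `i + 1` as a natural number. [folklore] -/
theorem labelSucc_val (i : Fin splitIndex.lstar) : ((Setting.labelSucc i : splitIndex.Label) : ℕ) = (i : ℕ) + 1 := by
  simp [Setting.labelSucc, Fin.val_succ]

/-- **The local q-volume is `−3/4` at EVERY label of `𝔽_l^⋇`** (label-independence: the READING clause `hindep` of p419757 holds; the
`naturalQ` field of abc-iut-rp-s1's `SSFrame`). [folklore] -/
theorem linSetting_qLocal (i : Fin splitIndex.lstar) (vQ : splitIndex.VQ) : linSetting.qLocal (Setting.labelSucc i) vQ = -3 / 4 := by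
  unfold Setting.qLocal
  rw [(linSetting_regions_of_ne_zero (Setting.labelSucc_ne_zero i) vQ).2]
  show deepVol capL _ vQ (gbox (qDepth _)) = _
  rw [deepVol_gbox capL vQ (qDepth_le _), sum_qDepth, labelSucc_val, pow_succ, pow_succ]
  have h2 : (0 : ℝ) < 2 ^ (i : ℕ) := by positivity
  field_simp
  ring

/-- **The volume of EVERY Kummer image of the Θ-pilot at label `j` is `j²·(q-volume) = −3j²/4`** (HONEST `j²`-scaling: the READING clause
`hscaled` of p419757 / the `honestTheta` field of `SSFrame` holds, at every `m` and for the (Ind3)-union). [folklore] -/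
theorem linSetting_thetaVol (m : ℤ) (i : Fin splitIndex.lstar) (vQ : splitIndex.VQ) :
    (linFull.D linSetting.n).logvol _ vQ (linSetting.thetaRegion m (Setting.labelSucc i) vQ) =
        (((i : ℕ) + 1 : ℕ) : ℝ) ^ 2 * linSetting.qLocal (Setting.labelSucc i) vQ ∧
      (linFull.D linSetting.n).logvol _ vQ (linSetting.thetaRegion3 (Setting.labelSucc i) vQ) =
        (((i : ℕ) + 1 : ℕ) : ℝ) ^ 2 * linSetting.qLocal (Setting.labelSucc i) vQ := by
  have hj := Setting.labelSucc_ne_zero i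
  have e : (linFull.D linSetting.n).logvol _ vQ (gbox (thetaDepth (Setting.labelSucc i))) =
      (((i : ℕ) + 1 : ℕ) : ℝ) ^ 2 * linSetting.qLocal (Setting.labelSucc i) vQ := by
    show deepVol capL _ vQ _ = _
    rw [deepVol_gbox capL vQ (thetaDepth_le _), sum_thetaDepth, linSetting_qLocal, labelSucc_val]
    fin_cases i <;> norm_num
  rw [linSetting_thetaRegion, ← linSetting_thetaRegion3, (linSetting_regions_of_ne_zero hj vQ).1]
  exact ⟨e, e⟩

/-- **The local Θ-term is the hull volume `−j³/2^{j+1}`** (`−1/4` at `j = 1`, `−1` at `j = 2`). [folklore] -/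
theorem linSetting_thetaLocal (i : Fin splitIndex.lstar) (vQ : splitIndex.VQ) :
    linSetting.thetaLocal (Setting.labelSucc i) vQ =
      ((-(((Setting.labelSucc i : ℕ) : ℝ) ^ 3) / 2 ^ ((Setting.labelSucc i : ℕ) + 1) : ℝ) : WithTop ℝ) := by
  have hj := Setting.labelSucc_ne_zero i
  unfold Setting.thetaLocal
  rw [if_pos (linSetting_hullDefined _ vQ)]
  show ((deepVol capL _ vQ (linSetting.thetaHull (Setting.labelSucc i) vQ) : ℝ) : WithTop ℝ) = _
  rw [linSetting_thetaHull hj, deepVol_gbox capL vQ (topDepth_cube_le _), sum_topDepth]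
  congr 1; norm_cast

/-- The local Θ-term in the label `i + 1`: `−(i+1)³/(4·2^i)` — `−1/4` at label `1`, `−1` at label `2`. [folklore] -/
theorem linSetting_thetaLocal_untopD (i : Fin splitIndex.lstar) (vQ : splitIndex.VQ) :
    (linSetting.thetaLocal (Setting.labelSucc i) vQ).untopD 0 = -((((i : ℕ) + 1 : ℕ) : ℝ) ^ 3) / (4 * 2 ^ (i : ℕ)) := by
  rw [linSetting_thetaLocal, WithTop.untopD_coe, labelSucc_val]
  push_cast
  ring

/-- `−|log(Θ)|` is finite. [folklore] -/
theorem linSetting_thetaFinite : linSetting.ThetaFinite :=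
  ⟨fun i vQ => by rw [linSetting_thetaLocal]; exact WithTop.coe_ne_top, fun _ => Set.toFinite _⟩

end LinScaledWitness

end Summit.ABC.IUTFork.Cor312Vol

end
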